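import Literature.IUT.HodgeArakelov.LabelClassesOfCuspsCor24iiAssembly
import Literature.IUT.HodgeArakelov.LabelClassesOfCuspsCor24iProofs3R
import Literature.IUT.HodgeArakelov.PlusMinusTowerStableCurveBridgeH25ZHat
import Literature.IUT.HodgeTheaters.TemperedCoveringsProSigmaInertiaConj
import HarnessLib

/-!
# [IUTchII] Cor 2.4 (i)′ and (ii)(iii)′ over the agreement: the Rmk 2.4.1 datum `hΛ` DISCHARGED from "`I_x ≅ Ẑ`" and
# Def 2.3 (ii)′ BY NAME (proof-only assembly)

S. Mochizuki, *Inter-universal Teichmüller theory II*, kurims manuscript (Dec. 2020) §2, Def 2.3 (ii) p.68, Cor 2.4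
(i)–(iii) pp.69–71, Rmk 2.4.1 p.71; *… I*, §2, Cor 2.5 p.51 [cite: Mochizuki2012, II Cor 2.4 pp.69-71] (claim key
DISPUTED, D-0012: every [IUTchI]/[IUTchII] statement below is a HYPOTHESIS named by the tree's typed predicates;
nothing of the series is asserted).  PROOF-ONLY assembly (abc-iut cell, wave 5, seat abc-iut-w5-d121; nodes
**IUTchII:Cor2.4(i)** and **IUTchII:Cor2.4(ii)**, sub-DAG `plan/L6/SUBDAG-IUTchII-Cor-24.md` Assembly row; no
definitions; handed over by abc-iut-w4-d012 2026-08-26T01:20Z «it is YOURS (d184, else d121)», abc-iut-w5-d184's seat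
released 01:31Z).

The node-level closing theorems of abc-iut-w4-d012 (`cor24_i'_of_agreement`, p414109) and abc-iut-w5-d184
(`cor24_ii_iii'_of_agreement`, `cor24_ii_iii'_tri_of_agreement`, p415267) carry the Rmk 2.4.1 datum
`hΛ` — "every cuspidal inertia group `I` of `Π_v` contains, through the agreement, a nontrivial compact pro-`Σ` subgroup
of `Δ^tp_{X_v}`" — as a HYPOTHESIS.  Here `hΛ` is PROVED (`StableCurveAgreement.hΛ_of_equiv_zHat`) from: the second
sentence of Def 2.3 (ii) in the minimal form `hrel₂` (equivalently conjunct 2 of abc-iut-L6-t19's repaired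
`Def23_ii'`), the B13 agreement (abc-iut-L6-t7: a cuspidal inertia group of `Π^±_v` is carried onto a
`Π^tp_{X_v}`-conjugate of some `I_x`), and "`I_x ≅ Ẑ`" (abc-iut-L5-t11's `proSigmaAtom_conj_finiteIndex_of_equiv_zHat'`,
p415239, from `e : ∀ x, I_x ≃ₜ* Ẑ`): `I = I' ∩ Π_v` has finite index in `I'`, so its image has finite index in
`ι(t I_x t⁻¹)` and contains the image of a nontrivial compact pro-`Σ` subgroup of `Δ^tp_{X_v}`.  Consequently
(`cor24_i'_of_agreements_of_equiv_zHat`, `cor24_ii_iii'_of_agreements_of_equiv_zHat`)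
over abc-iut-w4-d012's REPAIRED per-`□` chain `cor24_i'_of_agreements` (p416675, finding F-w4d012-2: the
`ℍ`-dictionaries are taken PER admissible `Π_{v□}`, each over its own [IUTchI] §2 datum and agreement, since one datum
bakes in one sub-graph) both nodes' closing theorems hold with `hΛ` replaced by the NAMED inputs {`Def23_ii'`,
`e : I_x ≃ₜ* Ẑ`}; every other binder is as in the repaired chain (in particular the open-subgroup step (B) `h23vi`,
GAP-LEDGER G-w4d012-2, stays a hypothesis).  `cor24_ii_iii'_of_agreements_of_equiv_zHat` is at the same time the
per-`□` (non-vacuous) twin of abc-iut-w5-d184's `cor24_ii_iii'_of_agreement` that F-w4d012-2 asks for.  HONEST FRAMING: kernel checks of deductions between typed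
statements; typed ≠ proved; nothing here bears on [IUTchIII] Cor. 3.12.
-/

namespace Literature.IUT.HodgeArakelov

open Literature.IUT.HodgeTheaters
open Literature.AnabelianGeometry.SemiGraphs (IsProSigma)
open scoped Pointwise

universe u

namespace PlusMinusTower

namespace StableCurveAgreement

variable {S : BadPlaceSetting.{u}} {P : TopGroup.{u}} {T : TemperedCoverings S P}
  {W : PlusMinusTower T} {C : CuspidalInertiaData W} {D : StableCurveTemperedData.{u}}

/-- **IUTchII:Rmk2.4.1** (kurims p.71) / **IUTchI:Cor2.5** (p.51) — the datum `hΛ` of abc-iut-w4-d012's and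
abc-iut-w5-d184's closing theorems, PROVED from named inputs: for every cuspidal inertia group `I` of `Π_v`, some
nontrivial compact pro-`Σ` subgroup `Λ ⊆ Δ^tp_{X_v}` has `ι(Λ) ⊆ ê(I ∩ Π̂^±_v)`.  HYPOTHESES: the B13 agreement `A`,
the Def 2.3 (ii) clause `hrel₂` ("`I = I' ∩ Π_v`, of finite index in a cuspidal inertia group `I'` of `Π^±_v`"), and
`e : ∀ x, I_x ≃ₜ* Ẑ` (through abc-iut-L5-t11's `proSigmaAtom_conj_finiteIndex_of_equiv_zHat'`). PROVED.
[claim: Mochizuki2012, status: disputed] -/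
theorem hΛ_of_equiv_zHat (A : StableCurveAgreement W C D)
    (hrel₂ : ∀ I, C.IsCuspidalInertia W.piV I →
      ∃ I', C.IsCuspidalInertia W.piPM I' ∧ ((I' ⊓ W.piV).subgroupOf I').FiniteIndex ∧ I = I' ⊓ W.piV)
    (e : ∀ x : D.Cusp, ↥(D.inertiaTp x) ≃ₜ* HodgeTheaters.ZHat) :
    ∀ I : Subgroup W.Corhat, C.IsCuspidalInertia W.piV I →
      ∃ Λ : Subgroup D.DeltaTp, IsCompact (Λ : Set D.DeltaTp) ∧ Λ ≠ ⊥ ∧ IsProSigma D.graph.Sigma Λ ∧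
        (Λ.map D.DeltaTp.subtype).map D.ιX ≤ (I.subgroupOf W.pmHat).map A.eHat.toMonoidHom := by
  intro I hI
  obtain ⟨I', hI', hfi, rfl⟩ := hrel₂ I hI
  obtain ⟨hI'pm, x, t, hK⟩ := (A.inertia_iff I').mp hI'
  have hI'hat : I' ≤ W.pmHat := hI'pm.trans W.emb_le_pmHat
  -- `ê(I' ∩ Π_v) ⊆ ê(I') = ι(t I_x t⁻¹)`, of finite index
  have hJK : ((I' ⊓ W.piV).subgroupOf W.pmHat).map A.eHat.toMonoidHom ≤
      (MulAut.conj t • (D.inertiaTp x).map D.DeltaTp.subtype).map D.ιX := by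
    rw [← hK]
    exact Subgroup.map_mono (Subgroup.comap_mono inf_le_left)
  have hJfi : ((((I' ⊓ W.piV).subgroupOf W.pmHat).map A.eHat.toMonoidHom).subgroupOf
      ((MulAut.conj t • (D.inertiaTp x).map D.DeltaTp.subtype).map D.ιX)).FiniteIndex := by
    refine ⟨?_⟩
    change (((I' ⊓ W.piV).subgroupOf W.pmHat).map A.eHat.toMonoidHom).relIndex
      ((MulAut.conj t • (D.inertiaTp x).map D.DeltaTp.subtype).map D.ιX) ≠ 0
    rw [← hK, Subgroup.relIndex_map_map_of_injective _ _ A.eHat.injective,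
      Subgroup.relIndex_subgroupOf hI'hat]
    exact hfi.index_ne_zero
  obtain ⟨Λ, hΛJ, hΛc, hΛne, hΛS⟩ := D.proSigmaAtom_conj_finiteIndex_of_equiv_zHat' e x t _ hJK hJfi
  exact ⟨Λ, hΛc, hΛne, hΛS, hΛJ⟩

/-- `hΛ_of_equiv_zHat` from abc-iut-L6-t19's repaired named statement `Def23_ii' C W.piV W.piPM` (conjunct 2).
PROVED. [claim: Mochizuki2012, status: disputed] -/
theorem hΛ_of_equiv_zHat_of_def23ii' (A : StableCurveAgreement W C D) (hrel' : Def23_ii' C W.piV W.piPM)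
    (e : ∀ x : D.Cusp, ↥(D.inertiaTp x) ≃ₜ* HodgeTheaters.ZHat) :
    ∀ I : Subgroup W.Corhat, C.IsCuspidalInertia W.piV I →
      ∃ Λ : Subgroup D.DeltaTp, IsCompact (Λ : Set D.DeltaTp) ∧ Λ ≠ ⊥ ∧ IsProSigma D.graph.Sigma Λ ∧
        (Λ.map D.DeltaTp.subtype).map D.ιX ≤ (I.subgroupOf W.pmHat).map A.eHat.toMonoidHom :=
  A.hΛ_of_equiv_zHat (fun I hI => (hrel'.2.1 I).mp hI) e

end StableCurveAgreement

end PlusMinusTower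

/-! ### The two nodes' closing theorems with `hΛ` discharged -/

section Assembly

open Literature.IUT.HodgeTheaters
open Literature.AnabelianGeometry.SemiGraphs (IsProSigma)

variable {S : BadPlaceSetting.{u}} {P : TopGroup.{u}} {T : TemperedCoverings S P}
  {D : EtaleThetaData S.toThetaSetting P} {Dsc : StableCurveTemperedData.{u}}
  (Dec : SubgraphDecomposition S T D) (W : PlusMinusTower T) (C : CuspidalInertiaData W)
  {L : LabCuspStructure C} (Ld : LabelledDecomposition Dec L)

/-- **IUTchII:Cor2.4(i)′ over the agreements, Rmk 2.4.1 datum discharged** (kurims pp.69–71): abc-iut-w4-d012's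
REPAIRED closing theorem `cor24_i'_of_agreements` (p416675: input (A) from ONE agreement `A` with [IUTchI] Prop 2.4 (i);
input (C) from an `ℍ`-dictionary, a datum and an agreement PER admissible `Π_{v□}` with [IUTchI] Cor 2.3 (ii)/(v)) for a
cuspidal inertia group `I` of `Π_v` (`hI`, `hIker`), with `hΛ` supplied by `hΛ_of_equiv_zHat_of_def23ii'`.  HYPOTHESES
(named, none asserted): `A`, `Dsc.Prop24i`, [IUTchII] Def 2.3 (ii)′ `Def23_ii'`, `e : I_x ≃ₜ* Ẑ`, the per-`□` data `Dic`,
and the open-subgroup step (B) `h23vi` (GAP-LEDGER G-w4d012-2). PROVED. [claim: Mochizuki2012, status: disputed]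
(IUTchII §2 Cor 2.4 (i), kurims pp.69-71) -/
theorem cor24_i'_of_agreements_of_equiv_zHat {I : Subgroup W.Corhat} (A : W.StableCurveAgreement C Dsc)
    (h24i : Dsc.Prop24i) (hrel' : Def23_ii' C W.piV W.piPM) (e : ∀ x : Dsc.Cusp, ↥(Dsc.inertiaTp x) ≃ₜ* HodgeTheaters.ZHat)
    (hI : C.IsCuspidalInertia W.piV I) (hIker : I ≤ W.aug.ker)
    (Dic : ∀ H : Subgroup P, Cor24_family Dec Ld H →
      ∃ (D' : StableCurveTemperedData.{u}) (A' : W.StableCurveAgreement C D'),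
        A'.SubgraphDictionary H ∧ D'.Cor23ii ∧ D'.Cor23v)
    (h23vi : ∀ H : Subgroup P, Cor24_family Dec Ld H →
      ∀ γ' : W.Corhat, γ' ∈ W.piPM ⊓ W.aug.ker →
        I.map (MulAut.conj γ').toMonoidHom ≤ W.pmBox H → γ' ∈ closure (W.deltaPmBox H : Set W.Corhat)) :
    Literature.IUT.HodgeArakelov.Cor24_i' Dec W C Ld I :=
  cor24_i'_of_agreements Dec W C Ld I A h24i hIker (A.hΛ_of_equiv_zHat_of_def23ii' hrel' e I hI) Dic h23vi

/-- **IUTchII:Cor2.4(ii)(iii)′ over the agreements, Rmk 2.4.1 datum discharged — the per-`□` twin of abc-iut-w5-d184's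
`cor24_ii_iii'_of_agreement`** (kurims p.70; finding F-w4d012-2): for an admissible `Π_{v□}` (`hH`), `Cor24_ii_iii' W C H`
from: ONE agreement `A` over the datum `Dsc` OF THE TARGET `□` with [IUTchI] Prop 2.4 (i) (`Prop24i`), Cor 2.3 (iii) under
its hypotheses (`Cor23iii`, `Cor23Hyp`) and the `Π`-level dictionary entry `hBox` for `Π_{v□}` (input (S), abc-iut-w5-d184's
`boxOntoGalois_of_cor23iii`); [IUTchII] Def 2.3 (ii)′ `Def23_ii'` and `e : I_x ≃ₜ* Ẑ` (replacing `hΛ`); per admissible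
`Π_{v□'}` a datum, an agreement and an `ℍ`-dictionary with Cor 2.3 (ii)/(v) (`Dic`); the open-subgroup step (B) `h23vi`
(GAP-LEDGER G-w4d012-2); input (E) `hcap`; sub-node (a.2) `hYdd` — ALL HYPOTHESES, none asserted. PROVED (composition of
`cor24_ii_iii'_of_inputs`, `cor24_i'_of_agreements`, `hΛ_of_equiv_zHat_of_def23ii'`, `boxOntoGalois_of_cor23iii`).
[claim: Mochizuki2012, status: disputed] (IUTchII §2 Cor 2.4 (ii), kurims p.70) -/
theorem cor24_ii_iii'_of_agreements_of_equiv_zHat {H : Subgroup P} (hH : Cor24_family Dec Ld H)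
    (A : W.StableCurveAgreement C Dsc) (h24i : Dsc.Prop24i) (hHyp : Dsc.Cor23Hyp) (h23iii : Dsc.Cor23iii)
    (hrel' : Def23_ii' C W.piV W.piPM) (e : ∀ x : Dsc.Cusp, ↥(Dsc.inertiaTp x) ≃ₜ* HodgeTheaters.ZHat)
    (Dic : ∀ H' : Subgroup P, Cor24_family Dec Ld H' →
      ∃ (D' : StableCurveTemperedData.{u}) (A' : W.StableCurveAgreement C D'),
        A'.SubgraphDictionary H' ∧ D'.Cor23ii ∧ D'.Cor23v)
    (hBox : ((W.pmBox H).subgroupOf W.pmHat).map A.eHat.toMonoidHom = Dsc.piTpXH.map Dsc.ιX)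
    (h23vi : ∀ I : Subgroup W.Corhat, C.IsCuspidalInertia W.piV I → ∀ H' : Subgroup P, Cor24_family Dec Ld H' →
      ∀ γ' : W.Corhat, γ' ∈ W.piPM ⊓ W.aug.ker →
        I.map (MulAut.conj γ').toMonoidHom ≤ W.pmBox H' → γ' ∈ closure (W.deltaPmBox H' : Set W.Corhat))
    (hcap : W.pmBox H ⊓ W.piV ≤ W.box H)
    (hYdd : ∀ I : Subgroup W.Corhat, C.IsCuspidalInertia W.piV I → I ≤ W.deltaBox H →
      W.cuspDecomp I 1 ≤ (T.YddL).map (W.emb.comp T.incl)) :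
    Literature.IUT.HodgeArakelov.Cor24_ii_iii' W C H :=
  cor24_ii_iii'_of_inputs
    (fun I hI hIΔ =>
      cor24_i'_of_agreements Dec W C Ld I A h24i (hIΔ.trans inf_le_right)
        (A.hΛ_of_equiv_zHat_of_def23ii' hrel' e I hI) Dic (h23vi I hI) H hH)
    (A.boxOntoGalois_of_cor23iii hBox hHyp h23iii) hcap hYdd

end Assembly

end Literature.IUT.HodgeArakelov
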